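import Summits.QuantumFields.BalabanUV.Beta.CombChartJointEnd
import Summits.QuantumFields.BalabanUV.Beta.SymSecondOrderTablesAn1
import Summits.QuantumFields.BalabanUV.Beta.RelInvBorderedHessian

/-!
# `BalabanUV.Beta.CombOneShotJets` — binder row D1 (OWNER an2), (J1) ∕ TID § F.10 (L3′): **THE ONE-SHOT COMPOSITE JET DATA OF THE CHART-(III′) LITERAL —
# `JcOf hLc N cΛ cB m : JetData 3 (Lc^m)` := THE (III′) FAMILY's LEVEL-0 MEMBER AT BLOCKING `Lc^m`** — and the depth-0 naming `hbase : TshotOf Lc Jc 1 = TbalOf Lc Js 0`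

WHY.  ROOT M‴ (`CombRemainderParityAll.d1Drift_JsB12CombShSym_an1TablesS2_pinned_of_locks_D1Tel_D1Rep`, p325680) displays `htel : D1Tel Lc Js Jc` and `hrep : D1Rep Lc Jc …`
with ONE composite family `Jc : ∀ m, JetData 3 (Lc^m)` FREE and SHARED by road «FP» (`D1Tel = HessianTelescoping Lc (TbalOf Lc Js) (TshotOf Lc Jc)`, reached through
an4's `HessianTelescopingKKT.d1Tel_of_stepRecursion_of_stepWard`, RULING R-FP-57) and road «BF-x» (`D1Rep`: `secondMoment (TshotOf Lc Jc m)` against the free sums;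
R-D1-g41-1 (2) binds `SB := SbfOf (S n) …` with `S n` the one-shot literal's first table at `n = Lc^m`).  The (J-a) dictionary's one-shot column (JA-TABLE v1.4 Δ4)
reads the literal ONE-SHOT at blocking `n = Lc^m`, level 0: first order `cE•wilsonA + cVH•mfNeg (symVhSAt ρ_c n) + cΛ•SLam n (lamCoeffOf (KInv n) n) (symHessFFAt ρ_c n)`,
second order `WcombOf … 0` at `Lc := n`, pins `(cE, cVH, cE₂) = (n⁴, −n⁸∕2, n⁸)` — i.e. EXACTLY the level-`0` member of `JsB12CombShSym` at blocking `n`.  This file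
NAMES that object (a `def`, asserting nothing) so both roads bind the same `Jc`, and proves the depth-0 naming an4's theorem asks for.

WHAT.
* §1 **`JcOf hLc N cΛ cB : ∀ m, JetData 3 (Lc^m)`** := `fun m ↦ JsB12CombShSym (Lc := Lc^m) hLc.pow N (symTablesAn1S2 3 (Lc^m) (cΛ m)) (cΛ m) (cB m) 0` — the lock
  NUMERALS stay free functions `cΛ cB : ℕ → ℝ` of the scale (the consumer displays `cΛ m · (Lc^m)⁴ = 2`, `cB m = −(Lc^m)¹²∕4` as at the root); `JcOf_apply` (`rfl`).
* §2 `TOf_JsB12CombShSym_congr` (transport of the one-shot kernel along an equality of blockings — `Lc¹ = Lc` is not definitional) and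
  **`TshotOf_JcOf_one`**: `TshotOf Lc (JcOf hLc N cΛ cB) 1 = TbalOf Lc (JsB12CombShSym hLc N (symTablesAn1S2 3 Lc (cΛ 1)) (cΛ 1) (cB 1)) 0` — the `hbase`
  binder of `d1Tel_of_stepRecursion_of_stepWard` at the (III′) literal whose level-0 locks are `cΛ 1, cB 1` (`BorderedHessian.KInvStep_zero_eq`, `OneStepKernelFamily.vertexOfK_KInv`).
WHAT THIS IS NOT: not `StepRecursion` (the road's (L1)+(L2′)); not a claim that Bałaban's `m`-fold composite system IS this one-shot literal beyond level 0's
tables (that identification is the content of (C1) column factorisation + `hId₁∕hId₂`, TID § F.10 (L2′)); nothing of Bałaban's asserted; `D1Tel` ∕ `D1Rep` OPEN;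
NOT (T-ID), NOT D1, NEVER «G-an2-4 closed», NOT BetaPertH, NOT continuum, NOT Clay.

HONEST DEPENDENCY (page 1, mandatory): continuum YM on T⁴ ⇐ BetaPertH ∧ nine spine estimates (0/9 proved); BetaPertH ⇐ (D1) ∧ (D4) ∧ CAP+tail;
G-an2-4 gates asym, D1 and NE2/3/4.  HONEST FRAMING (cell contract, verbatim): «discharging `BetaPertH` makes Bałaban's UV stability UNCONDITIONAL —
a real constructive-QFT result; it is NOT the continuum limit and NOT the Clay problem.»  ABSOLUTE RULE (cell charter, verbatim): «No internally-minted
statement may enter as a cited fact. Every hypothesis is either kernel-proved in this package or a verbatim quotation of a PUBLISHED theorem with page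
reference. The manuscript(s) under audit are NOT citable for their own disputed steps — they are the thing under adjudication; programme-internal
(2001/route/tribunal) claims are never citable.»  [our object] one `def` (a NAME over the displayed (III′) table record) + [folklore] two lemmas; nothing cited,
no `def … : Prop`, 0 sorry.  Row D1 OWNER an2 (b2b-balaban-beta-an2) gen 42, 2026-08-22.  No existing file touched.
-/

noncomputable section

namespace Summit.QuantumFields.BalabanUV.Beta.CombOneShotJets

open Literature.MathematicalPhysics.QuantumFieldTheory.Balaban1983to89
open Literature.MathematicalPhysics.QuantumFieldTheory.Balaban1983to89.Beta
open OneStepResolventKernel (JetData TOf)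
open OneStepKernelFamily (TshotOf TbalOf TstepOf vertexOfK vertexOfK_KInv)
open Summit.QuantumFields.BalabanUV.Beta.BorderedHessian (KInvStep_zero_eq)
open Summit.QuantumFields.BalabanUV.Beta.SymSecondOrderTablesAn1 (symTablesAn1S2)
open Summit.QuantumFields.BalabanUV.Beta.CombChartJointEnd (JsB12CombShSym)

variable {Lc : ℕ} [NeZero Lc]

/-! ## §1 The one-shot composite jet data of the (III′) literal -/

/-- [our object — a NAME over the displayed (III′) table record, asserting nothing] **THE ONE-SHOT COMPOSITE JET DATA** at scale `m`: the level-`0` member of the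
chart-(III′) literal `JsB12CombShSym` AT BLOCKING `Lc^m` (tables `symTablesAn1S2 3 (Lc^m) (cΛ m)`; pins `(cE, cVH, cE₂) = ((Lc^m)⁴, −(Lc^m)⁸∕2, (Lc^m)⁸)` built in;
the lock numerals `cΛ cB : ℕ → ℝ` free functions of the scale). -/
def JcOf (hLc : Odd Lc) (N : ℕ) (cΛ cB : ℕ → ℝ) : ∀ m : ℕ, JetData 3 (Lc ^ m) := fun m =>
  JsB12CombShSym (Lc := Lc ^ m) (hLc.pow) N (symTablesAn1S2 3 (Lc ^ m) (cΛ m)) (cΛ m) (cB m) 0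

/-- [folklore] `JcOf` unfolded (`rfl`). -/
theorem JcOf_apply (hLc : Odd Lc) (N : ℕ) (cΛ cB : ℕ → ℝ) (m : ℕ) :
    JcOf hLc N cΛ cB m = JsB12CombShSym (Lc := Lc ^ m) (hLc.pow) N (symTablesAn1S2 3 (Lc ^ m) (cΛ m)) (cΛ m) (cB m) 0 := rfl

/-! ## §2 The depth-0 naming `hbase : TshotOf Lc Jc 1 = TbalOf Lc Js 0` -/

/-- [folklore] transport of the one-shot kernel of the level-0 member along an equality of blockings (both sides are lattice kernels on `ℤ⁴`; `subst`). -/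
theorem TOf_JsB12CombShSym_congr {n : ℕ} [NeZero n] (hn : Odd n) (hLc : Odd Lc) (h : n = Lc) (N : ℕ) (c b : ℝ) :
    TOf (N := n) (JsB12CombShSym (Lc := n) hn N (symTablesAn1S2 3 n c) c b 0)
      = TOf (N := Lc) (JsB12CombShSym hLc N (symTablesAn1S2 3 Lc c) c b 0) := by
  subst h; rfl

/-- [folklore] **`hbase` — THE ONE-SHOT KERNEL AT DEPTH 1 IS THE ONE-STEP KERNEL AT LEVEL 0**: `TshotOf Lc (JcOf hLc N cΛ cB) 1 = TbalOf Lc (JsB12CombShSym hLc N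
(symTablesAn1S2 3 Lc (cΛ 1)) (cΛ 1) (cB 1)) 0` (`Lc¹ = Lc` by transport, `KInvStep Lc 0 = KInv`, `vertexOfK KInv Lc = vertexOf`). -/
theorem TshotOf_JcOf_one (hLc : Odd Lc) (N : ℕ) (cΛ cB : ℕ → ℝ) :
    TshotOf Lc (JcOf hLc N cΛ cB) 1 = TbalOf Lc (JsB12CombShSym hLc N (symTablesAn1S2 3 Lc (cΛ 1)) (cΛ 1) (cB 1)) 0 := by
  show TOf (N := Lc ^ 1) (JcOf hLc N cΛ cB 1) = TstepOf Lc 0 _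
  rw [JcOf_apply, TOf_JsB12CombShSym_congr (hLc.pow) hLc (pow_one Lc)]
  unfold TOf TstepOf
  rw [KInvStep_zero_eq, show vertexOfK (OneStepResolventKernel.KInv (N := Lc)) Lc
      (JsB12CombShSym hLc N (symTablesAn1S2 3 Lc (cΛ 1)) (cΛ 1) (cB 1) 0).S
    = OneStepResolventKernel.vertexOf (N := Lc) (JsB12CombShSym hLc N (symTablesAn1S2 3 Lc (cΛ 1)) (cΛ 1) (cB 1) 0).S from
    funext fun μ => funext fun y => vertexOfK_KInv _ μ y]

end Summit.QuantumFields.BalabanUV.Beta.CombOneShotJets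

end
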